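import Summits.NavierStokesRegularity.NavierStokesRegularity.Theorems.HodographBetchovFastClassSqueezeGerm
import Literature.Analysis.FluidPDE.NSCriticalClosureBesovKatoClass
import Literature.Analysis.FluidPDE.KatoRemainderL3
import Literature.Analysis.FluidPDE.RieszPressureSpaceTimeLp
import Literature.Analysis.FluidPDE.KatoRieszPressureSuitable
import Literature.Analysis.FluidPDE.SuitableWeakExhaustion
import Literature.Analysis.FluidPDE.SuitableWeakRescaling
import Literature.Analysis.FluidPDE.ClassicalSuitable
import Literature.Analysis.FluidPDE.TsaiTopSingularNullHolds
import Literature.Analysis.FluidPDE.ConstantinDirectionDissipationProofs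

/-!
# `FastClassSqueeze` (stmt-NavierStokesRegularity-15832): the top singular set is `ℋ¹`-null

Route `HodographBetchov`, crux 3; companion of `…FastClassSqueezeGerm.lean` (the crux localises to
germs of the flow at `{T} × Σ_T(u)`, `Σ_T(u) = {x | (T,x) is a backward singular point}`, compact).
Here: for every classical solution of unforced Navier–Stokes on `ℝ³ × [0,T)` which is Leray–Hopf
from its rapidly decaying datum,

  `μH[1] (Σ_T(u)) = 0`     (`hausdorffMeasure_topSingularSet`),

i.e. Caffarelli–Kohn–Nirenberg's Theorem B at the top slice (Tsai 1998, remark after Lemma 4.2, in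
the tree as the discharged fact `tsai1998_top_singular_null_holds`).  All inputs are theorems of the
tree; this file is bookkeeping of the classes:
* §1 `exists_suitable_rieszPressure`: the flow is a Kato `C_t L³` solution
  (`isKatoSolutionOn_of_classical`), lies in `L³((0,T) × ℝ³)` because its datum is bounded
  (`IsKatoSolutionOn.lintegral_enorm_cube_lt_top_of_ae_bounded`), so its space–time Riesz pressure
  `P ∈ L^{3/2}((0,T) × ℝ³)` exists (`exists_spaceTime_rieszPressure_of_memLp`) and `(u, P)` is a
  suitable weak solution on every interior slab `(0,S) × ℝ³`, `S < T`
  (`IsKatoSolutionOn.distributional_slab_of_pressure`, `.suitable_slab_of_pressure`), hence on the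
  open slab `(0,T) × ℝ³` (`IsSuitableWeakSolutionOn.of_exhaustion`: compact subsets stay below `T`).
* §2 on each cylinder `Q_ρ(T,x₀)`, `ρ² ≤ T`, the hypotheses of `tsai1998_top_singular_null` hold:
  suitability by restriction (`mono_holds`), `u ∈ L^∞_t L²_x` by the energy inequality, the classical
  gradient is a weak gradient (`hasWeakSpatialGradientOn_of_contDiffOn`) with
  `∫₀ᵀ∫|∇u|² < ∞` (`IsLerayHopfOn.lintegral_frobeniusNormSq_fderiv_of_classical`), `P ∈ L^{3/2}`;
  countably many such balls cover `ℝ³`.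
* §3 the localisation theorem of the crux, assembled: `Σ_T(u)` is compact and `ℋ¹`-null, and the fast
  class `{|u(t)| > l}` lies in any given open `U ⊇ Σ_T(u)` for all `t < T` once `l` is large.

References: Tsai, ARMA 143 (1998), Lemma 4.2 and remark (p. 46) [Tsai1998]; Caffarelli–Kohn–Nirenberg,
CPAM 35 (1982), Thm. B [CaffarelliKohnNirenberg1982]; Lemarié-Rieusset (2016), Thm. 15.1, Prop. 6.5
[LemarieRieusset2016]; Rusin–Šverák, JFA 260 (2011) §4 [RusinSverak2011].
-/

noncomputable section

-- the summit and its single problem share the name `NavierStokesRegularity` (D-0017 nested layout)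
set_option linter.dupNamespace false

namespace Summit.NavierStokesRegularity.NavierStokesRegularity.Theorems.FastClassSqueeze.Germ

open Set MeasureTheory Function Metric Filter Topology TopologicalSpace Literature.Analysis.FluidPDE
open scoped ENNReal NNReal Laplacian

/-! ### §1 A suitable pressure up to the final time -/

/-- **A Riesz pressure making the flow suitable on the whole open slab `(0,T) × ℝ³`.**  For
`ν, T > 0` and a classical solution `(u, p)` of unforced Navier–Stokes on `ℝ³ × [0,T)`, Leray–Hopf
from its rapidly decaying datum, there is `P ∈ L^{3/2}((0,T) × ℝ³)` with `(u, P)` a suitable weak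
solution on `(0,T) × ℝ³` (Kato theory on interior slabs, glued along `Sₙ ↑ T`).
[cite: LemarieRieusset2016, Thm. 15.1 (A), proof (file p. 565); Prop. 6.5] -/
theorem exists_suitable_rieszPressure {ν T : ℝ} (hν : 0 < ν) (hT : 0 < T)
    {u : ℝ → EuclideanSpace ℝ (Fin 3) → EuclideanSpace ℝ (Fin 3)}
    {p : ℝ → EuclideanSpace ℝ (Fin 3) → ℝ}
    (hcl : IsClassicalNSSolutionOn (Ico 0 T) ν 0 u p) (hLH : IsLerayHopfOn T ν 0 (u 0) u)
    (hdec : HasRapidSpatialDecay (u 0)) :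
    ∃ P : ℝ → EuclideanSpace ℝ (Fin 3) → ℝ,
      IsSuitableWeakSolutionOn (slab (EuclideanSpace ℝ (Fin 3)) (Ioo 0 T) isOpen_Ioo) ν 0 u P ∧
      ∫⁻ z in Ioo 0 T ×ˢ (univ : Set (EuclideanSpace ℝ (Fin 3))),
        ‖P z.1 z.2‖ₑ ^ (3 / 2 : ℝ) < ∞ := by
  have hK : IsKatoSolutionOn T ν (u 0) u := isKatoSolutionOn_of_classical hν hT hcl hLH hdec
  -- the datum is bounded (rapid decay with `n = K = 0`), so `u ∈ L³((0,T) × ℝ³)`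
  obtain ⟨C, hC⟩ := hdec 0 0
  have hbd : ∀ᵐ x ∂(volume : Measure (EuclideanSpace ℝ (Fin 3))), ‖u 0 x‖ ≤ C :=
    Eventually.of_forall fun x => by simpa using hC x
  have hL3 := hK.lintegral_enorm_cube_lt_top_of_ae_bounded hν hT hbd
  have hu3 : MemLp (uncurry u) 3
      (volume.restrict (Ioo 0 T ×ˢ (univ : Set (EuclideanSpace ℝ (Fin 3))))) := by
    refine ⟨hK.aestronglyMeasurable, ?_⟩
    rw [eLpNorm_lt_top_iff_lintegral_rpow_enorm_lt_top (by norm_num) (by norm_num)]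
    simpa [Function.uncurry] using hL3
  obtain ⟨P, -, hP32, hsl⟩ := exists_spaceTime_rieszPressure_of_memLp hT hu3
  have hPfin : ∫⁻ z in Ioo 0 T ×ˢ (univ : Set (EuclideanSpace ℝ (Fin 3))),
      ‖P z.1 z.2‖ₑ ^ (3 / 2 : ℝ) < ∞ := by
    have h32ne : (3 / 2 : ℝ≥0∞) ≠ 0 := by norm_num
    have h32top : (3 / 2 : ℝ≥0∞) ≠ ⊤ := by
      rw [ENNReal.div_eq_inv_mul]; exact ENNReal.mul_ne_top (by simp) (by simp)
    have e32 : (3 / 2 : ℝ≥0∞).toReal = 3 / 2 := by rw [ENNReal.toReal_div]; norm_num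
    have h := (eLpNorm_lt_top_iff_lintegral_rpow_enorm_lt_top h32ne h32top).1 hP32.2
    rw [e32] at h
    exact h
  -- exhaustion of `(0,T) × ℝ³` by the interior slabs `(0, S n) × ℝ³`, `S n ↑ T`
  set S : ℕ → ℝ := fun n => T * (((n : ℝ) + 1) / ((n : ℝ) + 2)) with hS
  have hS0 : ∀ n, 0 < S n := fun n => by positivity
  have hST : ∀ n, S n < T := fun n => by
    have h1 : ((n : ℝ) + 1) / ((n : ℝ) + 2) < 1 := by rw [div_lt_one (by positivity)]; linarith
    have h2 : S n = T * (((n : ℝ) + 1) / ((n : ℝ) + 2)) := rfl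
    rw [h2]; nlinarith
  have hSmono : ∀ n, S n ≤ S (n + 1) := fun n => by
    have h2 : ∀ m : ℕ, S m = T * (((m : ℝ) + 1) / ((m : ℝ) + 2)) := fun m => rfl
    rw [h2, h2]
    push_cast
    refine mul_le_mul_of_nonneg_left ?_ hT.le
    rw [div_le_div_iff₀ (by positivity) (by positivity)]
    nlinarith
  have hcov : ∀ t ∈ Ioo 0 T, ∃ n, t < S n := by
    intro t ht
    obtain ⟨n, hn⟩ := exists_nat_gt (t / (T - t))
    refine ⟨n, ?_⟩
    have h2 : S n = T * (((n : ℝ) + 1) / ((n : ℝ) + 2)) := rfl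
    rw [div_lt_iff₀ (by linarith [ht.2])] at hn
    rw [h2, mul_div_assoc', lt_div_iff₀ (by positivity)]
    nlinarith [ht.1, ht.2]
  let Qn : ℕ → Opens (ℝ × EuclideanSpace ℝ (Fin 3)) := fun n =>
    slab (EuclideanSpace ℝ (Fin 3)) (Ioo 0 (S n)) isOpen_Ioo
  have hle : ∀ n, Qn n ≤ slab (EuclideanSpace ℝ (Fin 3)) (Ioo 0 T) isOpen_Ioo := fun n z hz =>
    mem_slab.2 ⟨(mem_slab.1 hz).1, (mem_slab.1 hz).2.trans (hST n)⟩
  have hmono : Monotone Qn := by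
    refine monotone_nat_of_le_succ fun n z hz => ?_
    exact mem_slab.2 ⟨(mem_slab.1 hz).1, (mem_slab.1 hz).2.trans_le (hSmono n)⟩
  have hcovK : ∀ K ⊆ ((slab (EuclideanSpace ℝ (Fin 3)) (Ioo 0 T) isOpen_Ioo :
      Opens (ℝ × EuclideanSpace ℝ (Fin 3))) : Set (ℝ × EuclideanSpace ℝ (Fin 3))),
      IsCompact K → ∃ n, K ⊆ (Qn n : Set (ℝ × EuclideanSpace ℝ (Fin 3))) := by
    intro K hK hKc
    rcases K.eq_empty_or_nonempty with rfl | hne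
    · exact ⟨0, empty_subset _⟩
    obtain ⟨zmax, hzK, hzmax⟩ := hKc.exists_isMaxOn hne continuous_fst.continuousOn
    obtain ⟨n, hn⟩ := hcov zmax.1 (mem_slab.1 (hK hzK))
    exact ⟨n, fun z hz => mem_slab.2 ⟨(mem_slab.1 (hK hz)).1, lt_of_le_of_lt (hzmax hz) hn⟩⟩
  have hsuit : ∀ n, IsSuitableWeakSolutionOn (Qn n) ν 0 u P := by
    intro n
    have hsub : Ioo 0 (S n) ×ˢ (univ : Set (EuclideanSpace ℝ (Fin 3))) ⊆ Ioo 0 T ×ˢ univ :=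
      prod_mono (Ioo_subset_Ioo_right (hST n).le) Subset.rfl
    have hP32n : MemLp (uncurry P) (3 / 2 : ℝ≥0∞)
        (volume.restrict (Ioo 0 (S n) ×ˢ (univ : Set (EuclideanSpace ℝ (Fin 3))))) :=
      hP32.mono_measure (Measure.restrict_mono hsub le_rfl)
    have hsln : ∀ᵐ t ∂(volume.restrict (Ioo 0 (S n))), ∀ φ : EuclideanSpace ℝ (Fin 3) → ℝ,
        ContDiff ℝ (⊤ : ℕ∞) φ → HasCompactSupport φ →
          ∫ x, P t x * (Δ φ) x = -∫ x, fderiv ℝ (fderiv ℝ φ) x (u t x) (u t x) := by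
      filter_upwards [ae_restrict_of_ae_restrict_of_subset (Ioo_subset_Ioo_right (hST n).le) hsl]
        with t ht using ht.2.2.2.2
    have hNS := hK.distributional_slab_of_pressure hν (hST n) hP32n hsln
    have hpn : ∫⁻ z in Ioo 0 (S n) ×ˢ (univ : Set (EuclideanSpace ℝ (Fin 3))),
        ‖P z.1 z.2‖ₑ ^ (3 / 2 : ℝ) < ∞ := (lintegral_mono_set hsub).trans_lt hPfin
    exact hK.suitable_slab_of_pressure hν (hS0 n) (hST n) hNS hpn
  exact ⟨P, IsSuitableWeakSolutionOn.of_exhaustion hle hmono hcovK hsuit, hPfin⟩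

/-! ### §2 Tsai's remark on backward cylinders with vertex on the final slice -/

/-- **The top singular set is `ℋ¹`-null in every ball of radius `ρ`, `ρ² ≤ T`** (CKN Theorem B at
the top of the cylinder `Q_ρ(T, x₀) ⊆ (0,T) × ℝ³`, `tsai1998_top_singular_null_holds`, for the pair
`(u, P)` of `exists_suitable_rieszPressure`; energy class from the Leray–Hopf energy inequality,
weak gradient `∇u ∈ L²` from the classical gradient and the dissipation bound).
[cite: Tsai1998, Lemma 4.2 and the following remark (p. 46)] -/
theorem hausdorffMeasure_topSingularSet_ball {ν T : ℝ} (hν : 0 < ν) (hT : 0 < T)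
    {u : ℝ → EuclideanSpace ℝ (Fin 3) → EuclideanSpace ℝ (Fin 3)}
    {p : ℝ → EuclideanSpace ℝ (Fin 3) → ℝ}
    (hcl : IsClassicalNSSolutionOn (Ico 0 T) ν 0 u p) (hLH : IsLerayHopfOn T ν 0 (u 0) u)
    (hdec : HasRapidSpatialDecay (u 0)) (x₀ : EuclideanSpace ℝ (Fin 3)) {ρ : ℝ} (hρ : 0 < ρ)
    (hρT : ρ ^ 2 ≤ T) :
    μH[1] {x ∈ ball x₀ ρ | IsBackwardSingularPoint u (T, x)} = 0 := by
  obtain ⟨P, hsuit, hPfin⟩ := exists_suitable_rieszPressure hν hT hcl hLH hdec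
  -- the cylinder `Q_ρ(T, x₀)` lies in the open slab `(0,T) × ℝ³`
  have hQsub : parabolicCylinder ρ ((T : ℝ), x₀) ⊆ Ioo 0 T ×ˢ (univ : Set (EuclideanSpace ℝ (Fin 3))) := by
    intro w hw
    rw [mem_parabolicCylinder] at hw
    exact ⟨⟨by linarith [hw.1.1], hw.1.2⟩, mem_univ _⟩
  have hQle : parabolicCylinderOpens ρ ((T : ℝ), x₀) ≤
      slab (EuclideanSpace ℝ (Fin 3)) (Ioo 0 T) isOpen_Ioo := fun w hw =>
    mem_slab.2 (hQsub (show w ∈ parabolicCylinder ρ ((T : ℝ), x₀) from hw)).1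
  have hsuitQ : IsSuitableWeakSolutionOn (parabolicCylinderOpens ρ ((T : ℝ), x₀)) ν 0 u P :=
    IsSuitableWeakSolutionOn.mono_holds hsuit hQle
  -- energy class on the whole cylinder (Leray–Hopf energy inequality)
  have henergy : ∃ C : ℝ≥0, ∀ᵐ t : ℝ, t ∈ Ioo (T - ρ ^ 2) T →
      ∫⁻ x in ball x₀ ρ, ‖u t x‖ₑ ^ 2 ≤ C := by
    refine ⟨(ENNReal.ofReal (2 * VectorCalculus.kineticEnergy (u 0))).toNNReal,
      Eventually.of_forall fun t ht => ?_⟩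
    rw [ENNReal.coe_toNNReal ENNReal.ofReal_ne_top]
    exact (setLIntegral_le_lintegral _ _).trans
      (hLH.lintegral_enorm_sq_le hν.le ⟨by linarith [ht.1], ht.2.le⟩)
  -- the classical gradient is a weak gradient on the cylinder, square integrable
  have hcl' : IsClassicalNSSolutionOn (Ioo 0 T) ν 0 u p :=
    hcl.mono Ioo_subset_Ico_self isOpen_Ioo.uniqueDiffOn
  have hu1 : ContDiffOn ℝ 1 (uncurry u) (Ioo 0 T ×ˢ (univ : Set (EuclideanSpace ℝ (Fin 3)))) :=
    hcl'.smooth_velocity.of_le (by norm_cast)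
  have hwg : HasWeakSpatialGradientOn (parabolicCylinderOpens ρ ((T : ℝ), x₀)) u
      fun t x => fderiv ℝ (u t) x :=
    hasWeakSpatialGradientOn_of_contDiffOn isOpen_Ioo hQsub hu1
  have hgrad : ∫⁻ z in parabolicCylinder ρ ((T : ℝ), x₀),
      ENNReal.ofReal (frobeniusNormSq (fderiv ℝ (u z.1) z.2)) < ∞ := by
    obtain ⟨hDfin, -⟩ := IsLerayHopfOn.lintegral_frobeniusNormSq_fderiv_of_classical hcl hLH hT
    refine (lintegral_mono_set hQsub).trans_lt ?_
    have hprod : (volume.restrict (Ioo 0 T ×ˢ (univ : Set (EuclideanSpace ℝ (Fin 3)))) :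
        Measure (ℝ × EuclideanSpace ℝ (Fin 3))) = (volume.restrict (Ioo 0 T)).prod volume := by
      rw [show (volume : Measure (ℝ × EuclideanSpace ℝ (Fin 3))) = (volume : Measure ℝ).prod volume
        from rfl, ← Measure.prod_restrict, Measure.restrict_univ]
    have hF : AEMeasurable (fun z : ℝ × EuclideanSpace ℝ (Fin 3) =>
        ENNReal.ofReal (frobeniusNormSq (fderiv ℝ (u z.1) z.2))) ((volume.restrict (Ioo 0 T)).prod volume) := by
      rw [← hprod]
      have hc : ContinuousOn (fun z : ℝ × EuclideanSpace ℝ (Fin 3) => fderiv ℝ (u z.1) z.2)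
          (Ioo 0 T ×ˢ univ) := continuousOn_fderiv_slice_of_contDiffOn hu1 isOpen_Ioo.uniqueDiffOn
      exact (ENNReal.continuous_ofReal.comp_continuousOn
        (LerayHopfProofs.continuous_frobeniusNormSq.comp_continuousOn hc)).aemeasurable
        (measurableSet_Ioo.prod MeasurableSet.univ)
    rw [hprod, lintegral_prod _ hF]
    exact lt_top_iff_ne_top.2 hDfin
  have hp : ∫⁻ z in parabolicCylinder ρ ((T : ℝ), x₀), ‖P z.1 z.2‖ₑ ^ (3 / 2 : ℝ) < ∞ :=
    (lintegral_mono_set hQsub).trans_lt hPfin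
  exact tsai1998_top_singular_null_holds hν hρ hsuitQ henergy ⟨_, hwg, hgrad⟩ hp

/-- **The top singular set of a flow of the crux is `ℋ¹`-null**: `μH[1] (Σ_T(u)) = 0`
(countably many balls of radius `√T` centred at a dense sequence cover `ℝ³`).
[cite: Tsai1998, Lemma 4.2 and the following remark (p. 46)] -/
theorem hausdorffMeasure_topSingularSet {ν T : ℝ} (hν : 0 < ν) (hT : 0 < T)
    {u : ℝ → EuclideanSpace ℝ (Fin 3) → EuclideanSpace ℝ (Fin 3)}
    {p : ℝ → EuclideanSpace ℝ (Fin 3) → ℝ}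
    (hcl : IsClassicalNSSolutionOn (Ico 0 T) ν 0 u p) (hLH : IsLerayHopfOn T ν 0 (u 0) u)
    (hdec : HasRapidSpatialDecay (u 0)) :
    μH[1] {x : EuclideanSpace ℝ (Fin 3) | IsBackwardSingularPoint u (T, x)} = 0 := by
  set ρ : ℝ := Real.sqrt T with hρ_def
  have hρ : 0 < ρ := Real.sqrt_pos.2 hT
  have hρT : ρ ^ 2 ≤ T := (Real.sq_sqrt hT.le).le
  obtain ⟨D, hDc, hDd⟩ := TopologicalSpace.exists_countable_dense (EuclideanSpace ℝ (Fin 3))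
  have hcover : {x : EuclideanSpace ℝ (Fin 3) | IsBackwardSingularPoint u (T, x)} ⊆
      ⋃ q ∈ D, {x ∈ ball q ρ | IsBackwardSingularPoint u (T, x)} := by
    intro x hx
    obtain ⟨q, hqD, hxq⟩ := hDd.exists_dist_lt x hρ
    exact mem_iUnion₂.2 ⟨q, hqD, mem_ball.2 hxq, hx⟩
  exact measure_mono_null hcover ((measure_biUnion_null_iff hDc).2 fun q _ =>
    hausdorffMeasure_topSingularSet_ball hν hT hcl hLH hdec q hρ hρT)

/-! ### §3 The localisation theorem of the crux, assembled -/

/-- **Blow-up at `T` ⇔ a top singular point.**  For a flow of the crux on `[0,T)`, the top singular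
set `Σ_T(u)` is nonempty iff `u` has NO classical extension past `T`: an extension makes `u` bounded
on `[0,T) × ℝ³` (`bounded_of_hasSmoothExtensionPast`, Tao's persistence), so every cylinder
`Q_√T(T, x)` is regular; conversely a flow that does not extend has a singular point `(T, x₀)`
(`exists_singularPoint_of_classical_of_not_hasSmoothExtensionPast`: Lemarié-Rieusset 2016,
Thm. 15.1 (C), via Kato theory), singular at every scale (`eLpNorm_top_parabolicCylinder_eq_top_of_small`).
So the content of `FastClassSqueeze` is carried by flows with a NONEMPTY compact `ℋ¹`-null `Σ_T(u)`.
[cite: LemarieRieusset2016, Thm. 15.1 (C), pp. 565–566 and p. 570] -/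
theorem topSingularSet_nonempty_iff_not_hasSmoothExtensionPast {ν T : ℝ} (hν : 0 < ν) (hT : 0 < T)
    {u : ℝ → EuclideanSpace ℝ (Fin 3) → EuclideanSpace ℝ (Fin 3)}
    {p : ℝ → EuclideanSpace ℝ (Fin 3) → ℝ}
    (hcl : IsClassicalNSSolutionOn (Ico 0 T) ν 0 u p) (hLH : IsLerayHopfOn T ν 0 (u 0) u)
    (hdec : HasRapidSpatialDecay (u 0)) :
    {x : EuclideanSpace ℝ (Fin 3) | IsBackwardSingularPoint u (T, x)}.Nonempty ↔
      ¬ HasSmoothExtensionPast ν 0 u T := by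
  constructor
  · rintro ⟨x, hx⟩ hext
    obtain ⟨M, hM⟩ := bounded_of_hasSmoothExtensionPast ν T hν hT u p hcl hLH hdec hext
    -- the cylinder `Q_√T(T, x)` lies in `[0,T) × ℝ³`, where `‖u‖ ≤ M`
    have hbd : ∀ z ∈ parabolicCylinder (Real.sqrt T) ((T : ℝ), x), ‖uncurry u z‖ ≤ M := by
      intro z hz
      rw [mem_parabolicCylinder, Real.sq_sqrt hT.le] at hz
      exact hM z.1 ⟨by linarith [hz.1.1], hz.1.2⟩ z.2
    exact (not_isBackwardSingularPoint_iff.2 ⟨Real.sqrt T, Real.sqrt_pos.2 hT,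
      eLpNorm_top_lt_top_of_forall_le (isOpen_parabolicCylinder _ _).measurableSet hbd⟩) hx
  · intro hext
    obtain ⟨x₀, hx₀⟩ :=
      exists_singularPoint_of_classical_of_not_hasSmoothExtensionPast hν hT hcl hLH hdec hext
    exact ⟨x₀, fun r hr => eLpNorm_top_parabolicCylinder_eq_top_of_small hT hx₀ hr⟩

/-- **Localisation of `FastClassSqueeze` (stmt-NavierStokesRegularity-15832).**  For `ν, T > 0` and a
classical solution `(u, p)` of unforced Navier–Stokes on `ℝ³ × [0,T)`, Leray–Hopf from its rapidly
decaying datum, the top singular set `Σ_T(u) = {x | (T,x) is a backward singular point}` is COMPACT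
and `ℋ¹`-NULL, and the fast class concentrates on it: for every open `U ⊇ Σ_T(u)` there is `l₀` with
`{x | l < ‖u(t,x)‖} ⊆ U` for all `l ≥ l₀`, `t ∈ [0,T)`.  With `fastClassSqueeze_of_germSqueeze` the
crux is therefore a statement about germs of the flow at a compact `ℋ¹`-null subset of the final
slice. [cite: Tsai1998, Lemma 4.2 and the following remark (p. 46)] [cite: RusinSverak2011, §4 p. 6] -/
theorem topSingularSet_localisation : ∀ (ν T : ℝ), 0 < ν → 0 < T → ∀ (u : ℝ → EuclideanSpace ℝ (Fin 3) → EuclideanSpace ℝ (Fin 3)) (p : ℝ → EuclideanSpace ℝ (Fin 3) → ℝ), Literature.Analysis.FluidPDE.IsClassicalNSSolutionOn (Set.Ico 0 T) ν 0 u p → Literature.Analysis.FluidPDE.IsLerayHopfOn T ν 0 (u 0) u → Literature.Analysis.FluidPDE.HasRapidSpatialDecay (u 0) → IsCompact {x : EuclideanSpace ℝ (Fin 3) | Literature.Analysis.FluidPDE.IsBackwardSingularPoint u (T, x)} ∧ MeasureTheory.Measure.hausdorffMeasure 1 {x : EuclideanSpace ℝ (Fin 3) | Literature.Analysis.FluidPDE.IsBackwardSingularPoint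 u (T, x)} = 0 ∧ ∀ U : Set (EuclideanSpace ℝ (Fin 3)), IsOpen U → {x : EuclideanSpace ℝ (Fin 3) | Literature.Analysis.FluidPDE.IsBackwardSingularPoint u (T, x)} ⊆ U → ∃ l₀ : ℝ, ∀ l : ℝ, l₀ ≤ l → ∀ t ∈ Set.Ico 0 T, {x : EuclideanSpace ℝ (Fin 3) | l < ‖u t x‖} ⊆ U := by
  intro ν T hν hT u p hcl hLH hdec
  exact ⟨isCompact_topSingularSet hν hT hcl hLH hdec, hausdorffMeasure_topSingularSet hν hT hcl hLH hdec,
    fun U hU hSU => exists_fastClass_subset hν hT hcl hLH hdec hU hSU⟩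

end Summit.NavierStokesRegularity.NavierStokesRegularity.Theorems.FastClassSqueeze.Germ

end
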